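import Summits.HodgeConjecture.CorCM.Census.CoprimeCyclotomicProducts357AllTypes
import Literature.AlgebraicGeometry.Pohlmann1968.NondegenerateCMTypeHodgeConjecture
import HarnessLib

/-!
# Kubota-rank certificates for CM types of cyclotomic fields, read on residues

COR-CM (cell `pub-hodgecm2`), binder seat b04 (gen 11), count-neutral claim CYCLO-RANK-CENSUS (sequel of the A7
cyclotomic lane).  Generic level `N`; consumers: the census files `CorCM/CyclotomicRankCensus*.lean`.

SETTING.  `L` an `N`-th cyclotomic field, embeddings `σ : L → ℂ` read by their exponent `e(σ) ∈ (ℤ/N)ˣ`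
(`Pohlmann1968.Cyclotomic.expOf`), `Aut(ℂ)` acting through the cyclotomic character (`autExp`,
`e(τ ∘ σ) = u(τ) e(σ)`), conjugation by `e ↦ -e`; CM types `Φ_S = {σ | e(σ) ∈ S}` (`cmTypeOfResidues`), and EVERY CM
type of `L` is one (`Census.CoprimeCyclotomicProducts357.AllTypes.exists_eq_cmTypeOfResidues`).  The Kubota–Dodson
rank `cmTypeRank Φ` (dimension of the span of the indicators of the `Aut(ℂ)`-translates, Dodson §1.1) is `≤ n + 1`,
`2n = φ(N)` (`cmTypeRank_le`); equality = `IsNondegenerate Φ` gives `Bᵐ(Aⁿ) ⊗ ℂ = Dᵐ(Aⁿ) ⊗ ℂ` and the Hodge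
conjecture for every power of every realisation, UNCONDITIONALLY (`IsNondegenerate.hodgeConjectureFor_pow`).
The tree transports NEGATIVE finite data (`isPrimitive_of_residues`, `not_isNondegenerate_of_residues`) and, in
degree `≤ 6` or prime half-degree, gets nondegeneracy from print (Ribet, Yanai); for `φ(N) ∈ {8, 12}` a given type
needs a certificate, and the unitriangular device of `DegenerateCMTypeCyclotomic21.six_le_cmTypeRank_Φ₂₁` exists for
none of the primitive types of `ℚ(ζ₁₅)` (seat census).  This file (everything PROVED; the definitions are the
certificate tests and tables' shapes; no named fact, no `sorry`):

* §1 **`minorCert S u c M D`** (Boolean): units `u_i`, `c_j` and an integer matrix with `F · M = D · 1`, `D ≠ 0`,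
  `F_{ij} = [u_i c_j ∈ S]` an `r × r` minor of the translate matrix — A NONSINGULAR MINOR CERTIFIED BY AN INTEGER
  QUASI-INVERSE; **`le_cmTypeRank_of_minorCert`** (`r ≤ cmTypeRank Φ_S`: pair a vanishing combination of the
  translates `τ_i⁻¹Φ_S` with the functionals `v ↦ Σ_j M_{jk} v(σ_{c_j})`); **`isNondegenerate_of_minorCert`**.
* §2 **`not_isPrimitive_of_pair`**: units `a ≠ b` with `ua ∈ S ↔ ub ∈ S` for all units make `Φ_S` IMPRIMITIVE
  (converse of `isPrimitive_of_residues`): such types have no simple realisation.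
* §3 the Boolean checker **`censusB U certs pairs degs`** over the sublists of the unit list (list recursion only,
  no `Fintype` enumeration — the A7 lane's kernel-table hygiene): every CM residue set is keyed in `certs` (minor
  certificate of size `r`), `pairs` (non-separating pair) or `degs` (separating + balanced non-symmetric residue
  set + a smaller minor certificate); **`census_sound`** reads it back at the `Prop` level.
* §4 consumers (`r = n + 1`): **`trichotomy_of_census`**; with `degs = []`:
  **`isNondegenerate_iff_isPrimitive_of_census`**, `isNondegenerate_iff_isSimple_of_census` and the Hodge conjecture
  for every power of every SIMPLE realisation of every CM type of `L` (**`hodgeConjectureFor_pow_of_isSimple_of_census`**).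

## References

* [Dodson1987] B. Dodson, J. Algebra 111 (1987), §1.1 p. 50 (`Rank(Φ)`), Thm. 1.0.
* [Kubota1965] T. Kubota, Trans. AMS 118 (1965), §2 p. 115, Lemma 2.
* [Gordon1999HodgeAVSurvey] B. B. Gordon, *A survey of the Hodge conjecture for abelian varieties*, Thm. 6.4, §9.3–9.4.
* [Shimura1998] G. Shimura, *Abelian Varieties with Complex Multiplication and Modular Functions*, §8.2 Prop. 26.
* [Washington1997] L. C. Washington, *Introduction to Cyclotomic Fields*, Thm. 2.5.
-/
noncomputable section

open CategoryTheory CategoryTheory.Limits NumberField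
open scoped BigOperators

namespace Summit.HodgeConjecture.CorCM.CyclotomicRank

open Literature.NumberTheory.ComplexMultiplication
open Literature.AlgebraicGeometry.Motives (AbelianVariety CMType)
open Literature.AlgebraicGeometry.HodgeTheory
open Literature.AlgebraicGeometry.ComplexMultiplication (IsCMTypeRealisation isSimple_iff_isPrimitive)
open Literature.AlgebraicGeometry.VanGeemen1994 (hodgeClassSpan)
open Literature.Barriers.HodgeConjecture (divisorClassesSpan)
open Literature.AlgebraicGeometry.Pohlmann1968
open Literature.AlgebraicGeometry.Pohlmann1968.Cyclotomic
open Summit.HodgeConjecture.CorCM.Census.CoprimeCyclotomicProducts357.AllTypes (exists_eq_cmTypeOfResidues)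

/-! ### §1 Nonsingular minors of the translate matrix, certified by an integer quasi-inverse -/

section Minor

variable {N : ℕ} [NeZero N]

/-- The `(i,k)` entry of `F · M`, `F_{ij} = [u_i c_j ∈ K]` the minor of the translate matrix of the residue set
`K` (rows = translating units, columns = evaluation units). [cite: Dodson1987, §1.1 (p. 50)] -/
def minorEntry (K : List (ZMod N)) {r : ℕ} (u c : Fin r → ZMod N) (M : Fin r → Fin r → ℤ) (i k : Fin r) : ℤ :=
  ∑ j : Fin r, if u i * c j ∈ K then M j k else 0

/-- **Minor certificate** (Boolean) for the residue set `K`: units `u_i`, `c_j` and an integer matrix `M` with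
`F · M = D · 1`, `D ≠ 0` — the minor `F_{ij} = [u_i c_j ∈ K]` of the translate matrix is nonsingular.
[cite: Dodson1987, §1.1 (p. 50)] -/
def minorCert (K : List (ZMod N)) {r : ℕ} (u c : Fin r → ZMod N) (M : Fin r → Fin r → ℤ) (D : ℤ) : Bool :=
  decide (D ≠ 0 ∧ (∀ i, (u i).val.Coprime N) ∧ (∀ j, (c j).val.Coprime N) ∧
    ∀ i k : Fin r, minorEntry K u c M i k = if i = k then D else 0)

variable {L : Type} [Field L] [NumberField L] [IsCyclotomicExtension {N} ℚ L]
variable {S : Finset (ZMod N)} {hS : ∀ c : ZMod N, c.val.Coprime N → (c ∈ S ↔ -c ∉ S)}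

/-- The indicator of a translate of `Φ_S`, read on exponents: `[τ ∘ σ ∈ Φ_S] = [u(τ) e(σ) ∈ S]`.
[cite: Washington1997, Thm. 2.5] -/
theorem translateInd_cmTypeOfResidues (τ : ℂ ≃+* ℂ) (σ : L →+* ℂ) :
    translateInd (cmTypeOfResidues (L := L) S hS).1 τ σ =
      if autExp N τ * expOf N L σ ∈ S then (1 : ℚ) else 0 := by
  have h : τ • σ ∈ (cmTypeOfResidues (L := L) S hS).1 ↔ autExp N τ * expOf N L σ ∈ S := by
    rw [ringEquiv_smul_def, RingEquiv.toRingHom_eq_coe, mem_cmTypeOfResidues_iff, expOf_comp]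
  by_cases hm : autExp N τ * expOf N L σ ∈ S
  · rw [translateInd_of_mem (h.2 hm), if_pos hm]
  · rw [translateInd_of_not_mem (fun h' => hm (h.1 h')), if_neg hm]

/-- **A certified nonsingular `r × r` minor gives `r ≤ Rank(Φ_S)`**: the translates `τ_i⁻¹ Φ_S` (`u(τ_i) = u_i`)
are linearly independent — pairing `Σ_i g_i 𝟙_{τ_i⁻¹Φ_S} = 0` with the functional `v ↦ Σ_j M_{jk} v(σ_{c_j})`
(`e(σ_{c_j}) = c_j`) gives `g_k D = 0`. [cite: Dodson1987, §1.1 (p. 50)] -/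
theorem le_cmTypeRank_of_minorCert {K : List (ZMod N)} (hK : ∀ x, x ∈ K ↔ x ∈ S) {r : ℕ} {u c : Fin r → ZMod N}
    {M : Fin r → Fin r → ℤ} {D : ℤ} (h : minorCert K u c M D = true) :
    r ≤ cmTypeRank (cmTypeOfResidues (L := L) S hS) := by
  classical
  obtain ⟨hD, hu, hc, hM⟩ := of_decide_eq_true h
  choose τ hτ using fun i : Fin r => exists_autExp_eq N (u i) (hu i)
  choose σ hσ using fun j : Fin r => exists_expOf_eq N L (c j) (hc j)
  let f : Fin r → (L →+* ℂ) → ℚ := fun i => translateInd (cmTypeOfResidues (L := L) S hS).1 (τ i)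
  have hval : ∀ i j, f i (σ j) = if u i * c j ∈ K then (1 : ℚ) else 0 := fun i j => by
    show translateInd _ (τ i) (σ j) = _
    rw [translateInd_cmTypeOfResidues, hτ, hσ]
    simp only [hK]
  have hpair : ∀ i k : Fin r, ∑ j, f i (σ j) * (M j k : ℚ) = if i = k then (D : ℚ) else 0 := fun i k => by
    have h1 : ∀ j, f i (σ j) * (M j k : ℚ) = ((if u i * c j ∈ K then M j k else 0 : ℤ) : ℚ) := fun j => by
      rw [hval]; split_ifs <;> simp
    simp_rw [h1]
    rw [← Int.cast_sum]
    have h2 := hM i k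
    unfold minorEntry at h2
    rw [h2]
    split_ifs <;> simp
  have hli : LinearIndependent ℚ f := by
    rw [Fintype.linearIndependent_iff]
    intro g hg k
    have heval : ∀ j, ∑ i, g i * f i (σ j) = 0 := fun j => by
      have := congrFun hg (σ j)
      simpa only [Finset.sum_apply, Pi.smul_apply, smul_eq_mul, Pi.zero_apply] using this
    have h0 : ∑ j, (M j k : ℚ) * ∑ i, g i * f i (σ j) = 0 := by simp [heval]
    have h1 : ∑ j, (M j k : ℚ) * ∑ i, g i * f i (σ j) = ∑ i, g i * ∑ j, f i (σ j) * (M j k : ℚ) := by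
      simp_rw [Finset.mul_sum]; rw [Finset.sum_comm]
      exact Finset.sum_congr rfl fun i _ => Finset.sum_congr rfl fun j _ => by ring
    rw [h1] at h0; simp_rw [hpair] at h0
    have h2 : g k * (D : ℚ) = 0 := by simpa [mul_ite, Finset.sum_ite_eq'] using h0
    exact (mul_eq_zero.1 h2).resolve_right (Int.cast_ne_zero.2 hD)
  have h1 : Module.finrank ℚ (Submodule.span ℚ (Set.range f)) = r := by
    rw [finrank_span_eq_card hli, Fintype.card_fin]
  have h3 := Submodule.finrank_mono (Submodule.span_mono (R := ℚ) (M := (L →+* ℂ) → ℚ)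
    (s := Set.range f) (t := Set.range fun g : ℂ ≃+* ℂ => translateInd (cmTypeOfResidues (L := L) S hS).1 g)
    (by rintro _ ⟨i, rfl⟩; exact ⟨τ i, rfl⟩))
  rwa [h1] at h3

omit [NeZero N] in
/-- `ℚ(ζ_N)` is a CM field for `N > 2` (Mathlib). [folklore] -/
theorem isCMField_of_two_lt [NeZero N] (hN : 2 < N) : IsCMField L :=
  IsCyclotomicExtension.Rat.isCMField L (S := {N}) ⟨N, rfl, hN⟩

/-- **Nondegeneracy from a minor certificate of full size `r = φ(N)/2 + 1`** (Kubota: `Rank ≤ n + 1` always).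
[cite: Kubota1965, §2 (p. 115)] [cite: Dodson1987, §1.1 (p. 51)] -/
theorem isNondegenerate_of_minorCert (hN : 2 < N) {K : List (ZMod N)} (hK : ∀ x, x ∈ K ↔ x ∈ S) {r : ℕ}
    (hr : N.totient / 2 + 1 = r) {u c : Fin r → ZMod N} {M : Fin r → Fin r → ℤ} {D : ℤ}
    (h : minorCert K u c M D = true) : IsNondegenerate (cmTypeOfResidues (L := L) S hS) := by
  haveI := isCMField_of_two_lt (L := L) hN
  have hle := cmTypeRank_le (cmTypeOfResidues (L := L) S hS)
  have hge := le_cmTypeRank_of_minorCert (L := L) (hS := hS) hK h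
  rw [isNondegenerate_iff, finrank_eq_totient N L] at *
  omega

end Minor

/-! ### §2 Non-separating pairs: imprimitive types -/

section Pair

variable {N : ℕ} [NeZero N] {L : Type} [Field L] [NumberField L] [IsCyclotomicExtension {N} ℚ L]
variable {S : Finset (ZMod N)} {hS : ∀ c : ZMod N, c.val.Coprime N → (c ∈ S ↔ -c ∉ S)}

/-- **A non-separating pair of units makes `Φ_S` imprimitive**: if `a ≠ b` are units with `ua ∈ S ↔ ub ∈ S` for
every unit `u`, the embeddings `σ_a ≠ σ_b` have the same `Aut(ℂ)`-pattern, contradicting Shimura's separation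
form of primitivity (`isPrimitive_iff_forall_eq`). [cite: Shimura1998, §8.2 Prop. 26] [cite: Washington1997, Thm. 2.5] -/
theorem not_isPrimitive_of_pair {a b : ZMod N} (ha : a.val.Coprime N) (hb : b.val.Coprime N) (hab : a ≠ b)
    (hpat : ∀ u : ZMod N, u.val.Coprime N → (u * a ∈ S ↔ u * b ∈ S)) (φ₀ : L →+* ℂ) :
    ¬IsPrimitive (ℂ ≃+* ℂ) (cmTypeOfResidues (L := L) S hS).1 φ₀ := by
  haveI := isPretransitive_ringEquiv_complex (K := L)
  rw [isPrimitive_iff_forall_eq]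
  intro hsep
  obtain ⟨s, hs⟩ := exists_expOf_eq N L a ha
  obtain ⟨s', hs'⟩ := exists_expOf_eq N L b hb
  have hss' : s = s' := hsep s s' fun τ => by
    rw [ringEquiv_smul_def, ringEquiv_smul_def, RingEquiv.toRingHom_eq_coe, mem_cmTypeOfResidues_iff,
      mem_cmTypeOfResidues_iff, expOf_comp, expOf_comp, hs, hs']
    exact hpat _ (coprime_autExp N τ)
  exact hab (by rw [← hs, ← hs', hss'])

end Pair

/-! ### §3 The Boolean census checker and its soundness -/

section Checker

variable {N : ℕ} [NeZero N]

/-- `l ⊆ U` reads a CM type: exactly one of `c, -c` for every `c ∈ U`. [folklore] -/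
def isCMTypeB (U l : List (ZMod N)) : Bool := U.all fun c => decide (c ∈ l ↔ -c ∉ l)

/-- Boolean non-separating-pair test: `a ≠ b` in `U` with `ua ∈ l ↔ ub ∈ l` for all `u ∈ U`. [cite: Shimura1998, §8.2 Prop. 26] -/
def pairB (U l : List (ZMod N)) (a b : ZMod N) : Bool :=
  decide (a ∈ U) && decide (b ∈ U) && !decide (a = b) && U.all fun u => decide (u * a ∈ l ↔ u * b ∈ l)

/-- Boolean separation test: the translates of `l` separate `U`. [cite: Shimura1998, §8.2 Prop. 26] -/
def sepB (U l : List (ZMod N)) : Bool :=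
  U.all fun a => U.all fun b => decide (a = b) || !(U.all fun u => decide (u * a ∈ l ↔ u * b ∈ l))

/-- Boolean balanced-residue-set test (`P ⊆ U`, `2 #{c ∈ P | uc ∈ l} = #P` for `u ∈ U`, some `c ∈ P` with
`-c ∉ P`). [cite: Gordon1999HodgeAVSurvey, §9.2 (9.2.1)] -/
def balancedB (U l : List (ZMod N)) (P : Finset (ZMod N)) : Bool :=
  decide (P ⊆ U.toFinset) && (U.all fun u => 2 * (P.filter fun c => u * c ∈ l).card == P.card) &&
    decide (∃ c ∈ P, -c ∉ P)

/-- Table of minor certificates of size `r` at level `N` (key = residue list). [cite: Dodson1987, §1.1] -/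
abbrev CertTable (N r : ℕ) := List (List (ZMod N) × (Fin r → ZMod N) × (Fin r → ZMod N) × (Fin r → Fin r → ℤ) × ℤ)

/-- Table of non-separating pairs at level `N` (key = residue list). [cite: Shimura1998, §8.2 Prop. 26] -/
abbrev PairTable (N : ℕ) := List (List (ZMod N) × ZMod N × ZMod N)
/-- Table of degenerate primitive types at level `N`: balanced residue set and a minor certificate of size `r'`
(key = residue list). [cite: Gordon1999HodgeAVSurvey, §9.4] -/
abbrev DegTable (N r' : ℕ) :=
  List (List (ZMod N) × Finset (ZMod N) × (Fin r' → ZMod N) × (Fin r' → ZMod N) × (Fin r' → Fin r' → ℤ) × ℤ)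

/-- **The census checker.**  Over every sublist `l` of `U` reading a CM type: `l` is keyed in `certs` with a valid
minor certificate, or in `pairs` with a non-separating pair, or in `degs` with separation, a balanced
non-symmetric residue set and a (smaller) minor certificate. [cite: Dodson1987, §1.1] -/
def censusB (U : List (ZMod N)) {r r' : ℕ} (certs : CertTable N r) (pairs : PairTable N)
    (degs : DegTable N r') : Bool :=
  U.sublists.all fun l =>
    !isCMTypeB U l ||
      (certs.any fun e => e.1 == l && minorCert l e.2.1 e.2.2.1 e.2.2.2.1 e.2.2.2.2) ||
      (pairs.any fun p => p.1 == l && pairB U l p.2.1 p.2.2) ||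
      (degs.any fun d => d.1 == l && sepB U l && balancedB U l d.2.1 &&
        minorCert l d.2.2.1 d.2.2.2.1 d.2.2.2.2.1 d.2.2.2.2.2)

variable {U : List (ZMod N)} {r r' : ℕ} {certs : CertTable N r} {pairs : PairTable N} {degs : DegTable N r'}

omit [NeZero N] in
/-- The residue list of `S ⊆ U`: `U.filter (· ∈ S)` reads `S` and is a sublist of `U`. [folklore] -/
theorem mem_filter_iff_of_subset {S : Finset (ZMod N)} (hSU : S ⊆ U.toFinset) (x : ZMod N) :
    x ∈ U.filter (fun c => decide (c ∈ S)) ↔ x ∈ S := by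
  rw [List.mem_filter, decide_eq_true_iff]
  exact ⟨fun h => h.2, fun h => ⟨List.mem_toFinset.1 (hSU h), h⟩⟩

omit [NeZero N] in
/-- **Soundness of the census checker**: for every CM residue set `S ⊆ U` one of the three certified
alternatives holds, read back at the `Prop` level on `S`. [cite: Dodson1987, §1.1] -/
theorem census_sound (hB : censusB U certs pairs degs = true) {S : Finset (ZMod N)} (hSU : S ⊆ U.toFinset)
    (hS : ∀ c ∈ U, (c ∈ S ↔ -c ∉ S)) :
    (∃ e ∈ certs, (∀ x, x ∈ e.1 ↔ x ∈ S) ∧ minorCert e.1 e.2.1 e.2.2.1 e.2.2.2.1 e.2.2.2.2 = true) ∨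
    (∃ p ∈ pairs, p.2.1 ∈ U ∧ p.2.2 ∈ U ∧ p.2.1 ≠ p.2.2 ∧ ∀ u ∈ U, (u * p.2.1 ∈ S ↔ u * p.2.2 ∈ S)) ∨
    (∃ d ∈ degs, (∀ x, x ∈ d.1 ↔ x ∈ S) ∧
      (∀ a ∈ U, ∀ b ∈ U, (∀ u ∈ U, (u * a ∈ S ↔ u * b ∈ S)) → a = b) ∧
      (d.2.1 ⊆ U.toFinset ∧ (∀ u ∈ U, 2 * (d.2.1.filter fun c => u * c ∈ S).card = d.2.1.card) ∧
        ∃ c ∈ d.2.1, -c ∉ d.2.1) ∧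
      minorCert d.1 d.2.2.1 d.2.2.2.1 d.2.2.2.2.1 d.2.2.2.2.2 = true) := by
  classical
  set l := U.filter (fun c => decide (c ∈ S)) with hl
  have hmem : ∀ x, x ∈ l ↔ x ∈ S := mem_filter_iff_of_subset hSU
  have hsub : l ∈ U.sublists := List.mem_sublists.2 List.filter_sublist
  have hall := List.all_eq_true.1 hB l hsub
  have hcm : isCMTypeB U l = true := by
    rw [isCMTypeB, List.all_eq_true]
    intro c hc
    rw [decide_eq_true_iff, hmem, hmem]
    exact hS c hc
  -- membership translations used below
  have hkey : ∀ K : List (ZMod N), (K == l) = true → ∀ x, x ∈ K ↔ x ∈ S := fun K hK x => by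
    rw [beq_iff_eq] at hK
    rw [hK]
    exact hmem x
  have hpat : ∀ a b : ZMod N, (U.all fun u => decide (u * a ∈ l ↔ u * b ∈ l)) = true ↔
      ∀ u ∈ U, (u * a ∈ S ↔ u * b ∈ S) := fun a b => by
    rw [List.all_eq_true]
    exact ⟨fun h u hu => by have := h u hu; rwa [decide_eq_true_iff, hmem, hmem] at this,
      fun h u hu => by rw [decide_eq_true_iff, hmem, hmem]; exact h u hu⟩
  simp only [hcm, Bool.not_true, Bool.false_or, Bool.or_eq_true, List.any_eq_true, Bool.and_eq_true] at hall
  rcases hall with (⟨e, he, hel, hcert⟩ | ⟨p, hp, hpl, hpair⟩) | ⟨d, hd, ⟨⟨hdl, hsep⟩, hbal⟩, hcert⟩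
  · refine Or.inl ⟨e, he, hkey _ hel, ?_⟩
    have hK : e.1 = l := by rwa [beq_iff_eq] at hel
    rwa [← hK] at hcert
  · refine Or.inr (Or.inl ⟨p, hp, ?_⟩)
    simp only [pairB, Bool.and_eq_true, decide_eq_true_iff, Bool.not_eq_true', decide_eq_false_iff_not] at hpair
    obtain ⟨⟨⟨ha, hb⟩, hab⟩, hpt⟩ := hpair
    exact ⟨ha, hb, hab, (hpat _ _).1 hpt⟩
  · refine Or.inr (Or.inr ⟨d, hd, hkey _ hdl, ?_, ?_, ?_⟩)
    · intro a ha b hb hab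
      rw [sepB, List.all_eq_true] at hsep
      have h1 := List.all_eq_true.1 (hsep a ha) b hb
      rw [Bool.or_eq_true, decide_eq_true_iff, Bool.not_eq_true', ← Bool.not_eq_true] at h1
      rcases h1 with h1 | h1
      · exact h1
      · exact absurd ((hpat a b).2 hab) h1
    · simp only [balancedB, Bool.and_eq_true, decide_eq_true_iff, List.all_eq_true, beq_iff_eq] at hbal
      obtain ⟨⟨hP, hb⟩, hns⟩ := hbal
      refine ⟨hP, fun u hu => ?_, hns⟩
      rw [← hb u hu]
      congr 2
      ext c
      simp only [Finset.mem_filter, hmem]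
    · have hK : d.1 = l := by rwa [beq_iff_eq] at hdl
      rwa [← hK] at hcert

end Checker

/-! ### §4 Consumers: nondegeneracy, simplicity and the Hodge conjecture from a census -/

section Consumers

variable {N : ℕ} [NeZero N] {L : Type} [Field L] [NumberField L] [IsCyclotomicExtension {N} ℚ L]
variable {U : List (ZMod N)} {r r' : ℕ} {certs : CertTable N r} {pairs : PairTable N} {degs : DegTable N r'}

/-- **Trichotomy from a census** (`r = φ(N)/2 + 1`): every CM type `Φ` of `ℚ(ζ_N)` is NONDEGENERATE, or IMPRIMITIVE,
or (keyed in the third list) primitive, DEGENERATE and of rank `≥ r'`. [cite: Dodson1987, §1.1 and Thm. 1.0]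
[cite: Gordon1999HodgeAVSurvey, §9.3–9.4] -/
theorem trichotomy_of_census (hN : 2 < N) (hU : ∀ c : ZMod N, c.val.Coprime N ↔ c ∈ U)
    (hr : N.totient / 2 + 1 = r) (hB : censusB U certs pairs degs = true) (Φ : CMType L) (φ₀ : L →+* ℂ) :
    IsNondegenerate Φ ∨ ¬IsPrimitive (ℂ ≃+* ℂ) Φ.1 φ₀ ∨
      (∃ d ∈ degs, ∃ hK : (∀ c : ZMod N, c.val.Coprime N → (c ∈ d.1.toFinset ↔ -c ∉ d.1.toFinset)),
        Φ = cmTypeOfResidues (L := L) d.1.toFinset hK ∧ IsPrimitive (ℂ ≃+* ℂ) Φ.1 φ₀ ∧ ¬IsNondegenerate Φ ∧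
          r' ≤ cmTypeRank Φ) := by
  classical
  have hU' : ∀ c : ZMod N, c.val.Coprime N ↔ c ∈ U.toFinset := fun c => by rw [List.mem_toFinset]; exact hU c
  obtain ⟨S, hSU, hS, rfl⟩ := exists_eq_cmTypeOfResidues N L U.toFinset hU' Φ
  have hS' : ∀ c ∈ U, (c ∈ S ↔ -c ∉ S) := fun c hc => hS c ((hU c).2 hc)
  rcases census_sound hB hSU hS' with ⟨e, -, heS, hcert⟩ | ⟨p, -, ha, hb, hab, hpat⟩ |
      ⟨d, hd, hdS, hsep, ⟨hP, hbal, hns⟩, hcert⟩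
  · exact Or.inl (isNondegenerate_of_minorCert hN heS hr hcert)
  · exact Or.inr (Or.inl (not_isPrimitive_of_pair ((hU _).2 ha) ((hU _).2 hb) hab
      (fun u hu => hpat u ((hU u).1 hu)) φ₀))
  · right; right
    have hSd : S = d.1.toFinset := by ext x; rw [List.mem_toFinset, hdS]
    subst hSd
    refine ⟨d, hd, hS, rfl, ?_, ?_, le_cmTypeRank_of_minorCert (fun x => by rw [List.mem_toFinset]) hcert⟩
    · exact isPrimitive_of_residues U.toFinset hU'
        (fun a ha b hb h => hsep a (List.mem_toFinset.1 ha) b (List.mem_toFinset.1 hb)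
          fun u hu => h u (List.mem_toFinset.2 hu)) φ₀
    · exact not_isNondegenerate_of_residues U.toFinset hU' hN hP
        (fun u hu => hbal u (List.mem_toFinset.1 hu)) hns

/-- **All primitive types nondegenerate** for a level whose census has no third list.
[cite: Dodson1987, §1.1] [cite: Kubota1965, §2] -/
theorem isNondegenerate_of_isPrimitive_of_census (hN : 2 < N) (hU : ∀ c : ZMod N, c.val.Coprime N ↔ c ∈ U)
    (hr : N.totient / 2 + 1 = r)
    (hB : censusB U certs pairs ([] : DegTable N r') = true)
    (Φ : CMType L) (φ₀ : L →+* ℂ) (hprim : IsPrimitive (ℂ ≃+* ℂ) Φ.1 φ₀) : IsNondegenerate Φ := by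
  rcases trichotomy_of_census hN hU hr hB Φ φ₀ with h | h | ⟨d, hd, -⟩
  · exact h
  · exact absurd hprim h
  · simp at hd

/-- **Nondegenerate ⟺ primitive** for such a level (⟹ is Kubota's, `IsNondegenerate.isPrimitive`).
[cite: Kubota1965, §2 (p. 115)] [cite: Dodson1987, §1.1] -/
theorem isNondegenerate_iff_isPrimitive_of_census (hN : 2 < N) (hU : ∀ c : ZMod N, c.val.Coprime N ↔ c ∈ U)
    (hr : N.totient / 2 + 1 = r)
    (hB : censusB U certs pairs ([] : DegTable N r') = true)
    (Φ : CMType L) (φ₀ : L →+* ℂ) : IsNondegenerate Φ ↔ IsPrimitive (ℂ ≃+* ℂ) Φ.1 φ₀ := by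
  haveI := isCMField_of_two_lt (L := L) hN
  exact ⟨fun h => h.isPrimitive φ₀, isNondegenerate_of_isPrimitive_of_census hN hU hr hB Φ φ₀⟩

variable {Φ : CMType L} {A : AbelianVariety ℂ} {ι : 𝓞 L →+* End A} {θ : L →+* Module.End ℂ (complexBetti A.X 1)}

/-- **Nondegenerate ⟺ the realisation is simple** for such a level (Shimura §8.2 Prop. 26: simple ⟺ primitive).
[cite: Shimura1998, §8.2 Prop. 26] [cite: Kubota1965, §2] -/
theorem isNondegenerate_iff_isSimple_of_census (hN : 2 < N) (hU : ∀ c : ZMod N, c.val.Coprime N ↔ c ∈ U)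
    (hr : N.totient / 2 + 1 = r)
    (hB : censusB U certs pairs ([] : DegTable N r') = true)
    (hA : IsCMTypeRealisation Φ A ι θ) : IsNondegenerate Φ ↔ A.IsSimple := by
  obtain ⟨s₀⟩ := (inferInstance : Nonempty (L →+* ℂ))
  rw [isNondegenerate_iff_isPrimitive_of_census hN hU hr hB Φ s₀, isSimple_iff_isPrimitive hA s₀]

/-- **`Bᵐ(Aⁿ) ⊗ ℂ = Dᵐ(Aⁿ) ⊗ ℂ` on every power of every SIMPLE realisation** of a CM type of such a level
(Hazama's criterion through nondegeneracy). [cite: Gordon1999HodgeAVSurvey, Thm. 6.4 and §9.3] -/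
theorem hodgeClassSpan_pow_eq_divisorClassesSpan_of_isSimple_of_census (hN : 2 < N)
    (hU : ∀ c : ZMod N, c.val.Coprime N ↔ c ∈ U) (hr : N.totient / 2 + 1 = r)
    (hB : censusB U certs pairs ([] : DegTable N r') = true)
    (hA : IsCMTypeRealisation Φ A ι θ) (hsimple : A.IsSimple) (n m : ℕ) :
    hodgeClassSpan (⨁ fun _ : Fin n => A).dim (⨁ fun _ : Fin n => A).X m =
      divisorClassesSpan (⨁ fun _ : Fin n => A).X (⨁ fun _ : Fin n => A).dim m := by
  haveI := isCMField_of_two_lt (L := L) hN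
  exact ((isNondegenerate_iff_isSimple_of_census hN hU hr hB hA).2 hsimple).hodgeClassSpan_pow_eq_divisorClassesSpan
    hA n m

/-- **The Hodge conjecture for every power `Aⁿ` of every SIMPLE realisation** of a CM type of such a level —
UNCONDITIONAL (no named fact). [cite: Gordon1999HodgeAVSurvey, Thm. 6.4 and §9.3] [cite: Deligne2000, §1] -/
theorem hodgeConjectureFor_pow_of_isSimple_of_census (hN : 2 < N) (hU : ∀ c : ZMod N, c.val.Coprime N ↔ c ∈ U)
    (hr : N.totient / 2 + 1 = r)
    (hB : censusB U certs pairs ([] : DegTable N r') = true)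
    (hA : IsCMTypeRealisation Φ A ι θ) (hsimple : A.IsSimple) (n : ℕ) :
    HodgeConjectureFor (⨁ fun _ : Fin n => A).dim (⨁ fun _ : Fin n => A).X := by
  haveI := isCMField_of_two_lt (L := L) hN
  exact ((isNondegenerate_iff_isSimple_of_census hN hU hr hB hA).2 hsimple).hodgeConjectureFor_pow hA n

/-- **The Hodge conjecture for every SIMPLE realisation** (`HodgeConjectureFor A.dim A.X`, `A.dim = φ(N)/2`) of a CM
type of such a level — UNCONDITIONAL. [cite: Gordon1999HodgeAVSurvey, §9.3] [cite: Deligne2000, §1] -/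
theorem hodgeConjectureFor_of_isSimple_of_census (hN : 2 < N) (hU : ∀ c : ZMod N, c.val.Coprime N ↔ c ∈ U)
    (hr : N.totient / 2 + 1 = r)
    (hB : censusB U certs pairs ([] : DegTable N r') = true)
    (hA : IsCMTypeRealisation Φ A ι θ) (hsimple : A.IsSimple) : HodgeConjectureFor A.dim A.X := by
  haveI := isCMField_of_two_lt (L := L) hN
  exact ((isNondegenerate_iff_isSimple_of_census hN hU hr hB hA).2 hsimple).hodgeConjectureFor hA

end Consumers

end Summit.HodgeConjecture.CorCM.CyclotomicRank

end
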